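/-
Copyright (c) 2026 the pub-hodgecm-mathlib formalisation cell (harness21).  Prover seat hodgecm-mathlib-K2E4-p11 (g8): Track B «K2-LIT»,
#184♮ = hLiu418 = stmt-HodgeConjecture-24832; socket #41 KIND W — the ∃-CARRIER CM ASSEMBLER of ★ p862959 `kindW_block_of_record` (LEAD F0P6-plan (g14) BATCH #140 (2)):
the seven carrier ∕ character letters DISCHARGED inside (★ p862988), the twenty open letters universally quantified over the chosen carriers.
THEOREMS ONLY (no `def`, no `instance`, no `notation`, no named-fact hypothesis, no `sorry`).
-/
import Summits.HodgeConjecture.HodgeConjecture.Theorems.K2LiuSiegelEisensteinKindWOfRecord   -- ★ p862959 (K2E4-p10) `kindW_block_of_record`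
import Summits.HodgeConjecture.HodgeConjecture.Theorems.K2LiuKindWCarrierOfRecord             -- ★ p862988 (this seat) `exists_kindW_carrierLetters`
import HarnessLib

/-!
# Crux `HLiu418`, socket #41, KIND W — `K2LiuKindWBlockOfRecordCM`: THE KIND-W PAYER HEAD WITH ITS CARRIERS BUILT INSIDE (∃-carrier assembler)

Cell `hodgecm-mathlib`, crux item hLiu418 = `stmt-HodgeConjecture-24832`; squad K2 ∕ K2Liu (L1, LEAD F0P6-plan (g14)), road `K2_Liu`, socket #41, KIND W block; consumer =
K2E3-typ2 (g2)'s tie at ★ TOP ED. 19∕20 (KW block, 13 slots).  Lane `--supports stmt-HodgeConjecture-24832 --as helper` (count-neutral helper; closes no socket by itself).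
Frame = ★ p862959's (`e : Fin 2 × Fin 1 ≃ Fin n`, `χ := toHeckeCharacter L lam⁻¹`, the TOP's `νN`).

THE MATHEMATICS [CasselsFrohlichANT1967, Ch. XV (Tate) §3.3], [KudlaRallis1994, §1–§2], [Tan1999, §2–§3].  ★ p862959 delivers the TOP's KIND-W block from 27 tie-side letters;
seven of them — the bad set `T₀`, the local carriers `νv` (Haar, σ-finite, `νv(K_{H,v} ∩ N_Δ(L⁺_v)) = 1`), the archimedean carriers `νinf T` (σ-finite) with the factorisation
`hmap` of `νN` at every finite `T`, and the unramifiedness `hχ` of `μ̃` off `T₀` — are THEOREMS (★ p862988 `exists_kindW_carrierLetters`).  Six of the remaining twenty letters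
MENTION the carriers (`hfac`: `T₀ ⊆ T`; `hJ`: `∂(νv v)`, `kindWPlaces ↑T₀`; `hPart`: `νinf`, `νv`, `kindWFinset T₀`; `hfsupp`∕`hfsize`: `kindWFinset T₀`), so the honest head is
**`kindW_block_cm : ∃ T₀ νv (Haar) (σ-finite) νinf (σ-finite), hνK ∧ hmap ∧ hχ ∧ ∀ ‹the twenty letters of ★ p862959, verbatim›, ‹★ p862959's conclusion, verbatim›`** —
the tie opens it with ONE `obtain` and feeds the twenty letters (payers of record: (KW-fac), (KW-J), (iii-fin)∕(iii-arch), ★ `hPart_of_letters`, (KW-fin) (A)(B), LH4-p08's arch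
reducer — LEAD BATCH #138∕#140 KW table).
HONEST LABEL.  Count-neutral helper; it retires nothing by itself: `HC_CM` is proved only modulo the 7 printed citations (2 remaining named inputs:
hLiu418 = `stmt-HodgeConjecture-24832`, h413 = `stmt-HodgeConjecture-24833`) until rung 0 closes.

## References
* [CasselsFrohlichANT1967] J. W. S. Cassels, A. Fröhlich (eds.), *Algebraic Number Theory* (1967), Ch. XV (Tate) §3.3.
* [KudlaRallis1994] S. Kudla, S. Rallis, Ann. of Math. 140 (1994), §1–§2.
* [Tan1999] V. Tan, Canad. J. Math. 51 (1999), §2–§3.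
-/

set_option autoImplicit false
set_option linter.dupNamespace false -- the mandated namespace repeats `HodgeConjecture.HodgeConjecture`

noncomputable section

open scoped Matrix BigOperators NNReal ENNReal ComplexConjugate RestrictedProduct
open scoped Classical
open NumberField NumberField.InfinitePlace IsDedekindDomain MeasureTheory Measure
open Literature.NumberTheory.Automorphic Literature.NumberTheory.GaloisRepresentations Literature.NumberTheory.LFunctions
open Literature.NumberTheory.GelbartRogawski1991 Literature.NumberTheory.GelbartRogawski1991.GRConstruction
open Literature.NumberTheory.K2Lit.SiegelDoubled Literature.NumberTheory.K2Lit.PlaceSplitting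
open Literature.MeasureTheory.RestrictedProduct
open Literature.Topology.Algebra.RestrictedProduct (inH)
open Literature.NumberTheory.Automorphic.IdeleClassGroup (toHeckeCharacter isUnitary_toHeckeCharacter)
open Summit.HodgeConjecture.HodgeConjecture.Cruxes.HLiu418.K2LiuSiegelUnipotentLocalDefs
open Summit.HodgeConjecture.HodgeConjecture.Cruxes.HLiu418.K2LiuSiegelUnipotentSplitAtDefs
open Summit.HodgeConjecture.HodgeConjecture.Cruxes.HLiu418.K2LiuSiegelUnipotentFourierDefs
open Summit.HodgeConjecture.HodgeConjecture.Cruxes.HLiu418.K2LiuSiegelEisensteinKindWLetters (kindWPlaces kindWFinset mem_kindWFinset integral_of_not_mem_kindWPlaces)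
open Summit.HodgeConjecture.HodgeConjecture.Cruxes.HLiu418.K2LiuSiegelEisensteinKindWEulerLetters (exists_kindW_eulerLetters_of_letters)
open Summit.HodgeConjecture.HodgeConjecture.Cruxes.HLiu418.K2LiuSiegelEisensteinKindWGlobalIntegrable (hG_of_isStandardSectionFamily)
open Summit.HodgeConjecture.HodgeConjecture.Cruxes.HLiu418.K2LiuSiegelEisensteinKindWPackage (exists_kindW_letters_of_globalLetters)
open Summit.HodgeConjecture.HodgeConjecture.Cruxes.HLiu418.K2LiuSiegelEisensteinKindWPresentation (sloc_of_presentation dloc_of_presentation)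
open Summit.HodgeConjecture.HodgeConjecture.Cruxes.HLiu418.K2LiuSiegelEisensteinKindWOfRecord (kindW_block_of_record)
open Summit.HodgeConjecture.HodgeConjecture.Cruxes.HLiu418.K2LiuKindWCarrierOfRecord (exists_kindW_carrierLetters)

namespace Summit.HodgeConjecture.HodgeConjecture.Cruxes.HLiu418.K2LiuKindWBlockOfRecordCM

/-- **THE KIND-W PAYER HEAD WITH ITS CARRIERS BUILT INSIDE.**  At ★ p862959's frame and the TOP's `νN`: there are a bad set `T₀`, local carriers `νv` (Haar, σ-finite, normalised on
`K_{H,v} ∩ N_Δ(L⁺_v)`), archimedean carriers `νinf T` (σ-finite) with the factorisation of `νN` at every finite `T`, and `μ̃ = toHeckeCharacter L lam⁻¹` unramified off `T₀` (★ p862988),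
such that FOR EVERY choice of ★ p862959's twenty remaining letters about them the TOP's KIND-W block holds (★ p862959 `kindW_block_of_record`).
[cite: CasselsFrohlichANT1967, Ch. XV (Tate) §3.3] [cite: KudlaRallis1994, §1–§2] [cite: Tan1999, §2–§3] -/
theorem kindW_block_cm
    (L : Type) [Field L] [NumberField L] [IsCMField L] {n : ℕ} (e : Fin 2 × Fin 1 ≃ Fin n)
    (dV : Fin 2 → L) (hdV : ∀ i, IsCMField.complexConj L (dV i) = dV i) (hdV0 : ∀ i, dV i ≠ 0)
    (dW : Fin 1 → L) (hdW : ∀ i, IsCMField.complexConj L (dW i) = dW i) (hdW0 : ∀ i, dW i ≠ 0)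
    (lam : IdeleClassGroup L →ₜ* Circle) (𝒦 : IwasawaDatum L e dV hdV dW hdW) (f : ℂ → HA L e dV hdV dW hdW → ℂ)
    (hstd : IsStandardSectionFamily 𝒦 (toHeckeCharacter L lam⁻¹) f) (hcont : ∀ s, Continuous (f s))
    [MeasurableSpace (unipDelta L e dV hdV dW hdW)] [BorelSpace (unipDelta L e dV hdV dW hdW)]
    (νN : Measure (unipDelta L e dV hdV dW hdW)) [νN.IsHaarMeasure]
    [DecidableEq (HeightOneSpectrum (𝓞 (Fp L)))]
    [MeasurableSpace (unipDeltaArch L e dV hdV dW hdW)] [BorelSpace (unipDeltaArch L e dV hdV dW hdW)]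
    [∀ v : HeightOneSpectrum (𝓞 (Fp L)), MeasurableSpace (unipDeltaLoc L e dV hdV dW hdW v)]
    [∀ v : HeightOneSpectrum (𝓞 (Fp L)), BorelSpace (unipDeltaLoc L e dV hdV dW hdW v)] :
    ∃ (T₀ : Finset (HeightOneSpectrum (𝓞 (Fp L))))
      (νv : ∀ v : HeightOneSpectrum (𝓞 (Fp L)), Measure (unipDeltaLoc L e dV hdV dW hdW v)) (_ : ∀ v, (νv v).IsHaarMeasure) (_ : ∀ v, SigmaFinite (νv v))
      (νinf : Finset (HeightOneSpectrum (𝓞 (Fp L))) → Measure (unipDeltaArch L e dV hdV dW hdW)) (_ : ∀ T, SigmaFinite (νinf T)),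
      (∀ v, νv v (((inH (fun v => UnitaryGroup.localInt L (IsCMField.complexConj L) (n + n) (hermD L e dV hdV dW hdW) v)
      (fun v => unipDeltaLoc L e dV hdV dW hdW v) v) : Subgroup (unipDeltaLoc L e dV hdV dW hdW v)) : Set (unipDeltaLoc L e dV hdV dW hdW v)) = 1) ∧
      (∀ T : Finset (HeightOneSpectrum (𝓞 (Fp L))), Measure.map (unipDeltaSplitAt L e dV hdV dW hdW T) νN =
      (νinf T).prod ((Measure.pi fun v : T => νv v.1).prod
        (rpMeasure (fun v : {v : HeightOneSpectrum (𝓞 (Fp L)) // v ∉ T} => ((inH (fun v => UnitaryGroup.localInt L (IsCMField.complexConj L) (n + n) (hermD L e dV hdV dW hdW) v)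
          (fun v => unipDeltaLoc L e dV hdV dW hdW v) v.1 : Subgroup (unipDeltaLoc L e dV hdV dW hdW v.1)) : Set (unipDeltaLoc L e dV hdV dW hdW v.1))) (fun v => νv v.1) ∅))) ∧
      (∀ v, v ∉ T₀ → ∀ w' : UnitaryGroup.PlacesOver L v, (toHeckeCharacter L lam⁻¹).IsUnramifiedAt w'.1) ∧
    ∀
        {fT : ∀ T : Finset (HeightOneSpectrum (𝓞 (Fp L))), ℂ → UnitaryGroup.arch (Fp L) L (IsCMField.complexConj L) (n + n) (hermD L e dV hdV dW hdW) ×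
          (Π v : T, UnitaryGroup.localPi L (IsCMField.complexConj L) (n + n) (hermD L e dV hdV dW hdW) v.1) → ℂ}
        (hfac : ∀ T : Finset (HeightOneSpectrum (𝓞 (Fp L))), T₀ ⊆ T → IsFactorizableOff L e dV hdV dW hdW T (toHeckeCharacter L lam⁻¹) f (fT T))
        -- the rank-two per-place letter off `U(S,h)`
        (hJ : ∀ (S : skewMatrices ((IsCMField.complexConj L : L ≃ₐ[Fp L] L) : L →+* L) ((gramR L e dV hdV dW hdW).map (algebraMap (Fp L) L))) (h : HA L e dV hdV dW hdW) (s : ℂ),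
          (n : ℝ) / 2 < s.re → (S : Matrix (Fin n) (Fin n) L).det ≠ 0 →
          ∀ v, v ∉ kindWPlaces L e dV hdV dW hdW (T₀ : Set (HeightOneSpectrum (𝓞 (Fp L)))) (S : Matrix (Fin n) (Fin n) L) h →
            ∫ y, conj (unipDeltaChar L e dV hdV dW hdW (S : Matrix (Fin n) (Fin n) L)
                  (locToAdelic L e dV hdV dW hdW v (y : UnitaryGroup.localPi L (IsCMField.complexConj L) (n + n) (hermD L e dV hdV dW hdW) v)) : ℂ) *
                LambdaLoc L e dV hdV dW hdW v (toHeckeCharacter L lam⁻¹) s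
                  (UnitaryGroup.evalPlace (Fp L) L (IsCMField.complexConj L) (n + n) (hermD L e dV hdV dW hdW) v
                      (UnitaryGroup.finPart (Fp L) L (IsCMField.complexConj L) (n + n) (hermD L e dV hdV dW hdW) (weylDelta L e dV hdV dW hdW)) *
                    (y : UnitaryGroup.localPi L (IsCMField.complexConj L) (n + n) (hermD L e dV hdV dW hdW) v)) ∂(νv v) =
              (1 - (v.residueCard : ℂ) ^ (-(2 * s + 1))) * (1 - (quadraticHeckeCharCM L).valueAtUniformizer v * (v.residueCard : ℂ) ^ (-(2 * s + 2))))
        -- the CONTINUED local letters (by value) and their holomorphy on `{0 < re s}`, with the half-plane identity `hPart`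
        {m : ℕ} (Finf : Fin m → skewMatrices ((IsCMField.complexConj L : L ≃ₐ[Fp L] L) : L →+* L) ((gramR L e dV hdV dW hdW).map (algebraMap (Fp L) L)) → ℂ → HA L e dV hdV dW hdW → ℂ)
        (Ffin : Fin m → skewMatrices ((IsCMField.complexConj L : L ≃ₐ[Fp L] L) : L →+* L) ((gramR L e dV hdV dW hdW).map (algebraMap (Fp L) L)) → HA L e dV hdV dW hdW →
          HeightOneSpectrum (𝓞 (Fp L)) → ℂ → ℂ)
        (hFinf : ∀ j S (h : HA L e dV hdV dW hdW), DifferentiableOn ℂ (fun s => Finf j S s h) {s : ℂ | 0 < s.re})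
        (hFfin : ∀ j S (h : HA L e dV hdV dW hdW) v, DifferentiableOn ℂ (Ffin j S h v) {s : ℂ | 0 < s.re})
        (hPart : ∀ (S : skewMatrices ((IsCMField.complexConj L : L ≃ₐ[Fp L] L) : L →+* L) ((gramR L e dV hdV dW hdW).map (algebraMap (Fp L) L))) (h : HA L e dV hdV dW hdW) (s : ℂ),
          (n : ℝ) / 2 < s.re → (S : Matrix (Fin n) (Fin n) L).det ≠ 0 →
          K2LiuSiegelEisensteinKindWLetters.kindWPart L e dV hdV dW hdW (kindWFinset L e dV hdV dW hdW T₀ (S : Matrix (Fin n) (Fin n) L) h)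
              (νinf (kindWFinset L e dV hdV dW hdW T₀ (S : Matrix (Fin n) (Fin n) L) h)) νv
              (fT (kindWFinset L e dV hdV dW hdW T₀ (S : Matrix (Fin n) (Fin n) L) h)) (S : Matrix (Fin n) (Fin n) L) s h =
            ∑ j, Finf j S s h * ∏ v ∈ kindWFinset L e dV hdV dW hdW T₀ (S : Matrix (Fin n) (Fin n) L) h, Ffin j S h v s)
        -- STAGE 2, the per-term letters BY VALUE: per-place support at the places of the presentation (defect datum `(T_δ, δ, k)`)
        (Tδ : Finset (HeightOneSpectrum (𝓞 L))) (δ : HeightOneSpectrum (𝓞 L) → ℕ) (hδ : ∀ w ∉ Tδ, δ w = 0) (k : ℕ)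
        (hfsupp : ∀ (v : HeightOneSpectrum (𝓞 (Fp L))) (j : Fin m)
          (S : skewMatrices ((IsCMField.complexConj L : L ≃ₐ[Fp L] L) : L →+* L) ((gramR L e dV hdV dW hdW).map (algebraMap (Fp L) L))) (s : ℂ) (h : HA L e dV hdV dW hdW),
          v ∈ kindWFinset L e dV hdV dW hdW T₀ (S : Matrix (Fin n) (Fin n) L) h → 0 < s.re → Ffin j S h v s ≠ 0 →
          ∀ w : UnitaryGroup.PlacesOver L v, ∃ m : ℕ,
            ((Ideal.absNorm w.1.asIdeal : ℕ) : ℝ) ^ m ≤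
                ((Ideal.absNorm w.1.asIdeal : ℕ) : ℝ) ^ δ w.1 * (GLn.localHeight (n + n) L w.1 (h : GL (Fin (n + n)) (AdeleRing (𝓞 L) L)) : ℝ) ^ k ∧
              ∀ a b, Valued.v ((((S : Matrix (Fin n) (Fin n) L) a b : L)) : w.1.adicCompletion L) ≤ WithZero.exp (m : ℤ))
        -- the ARCH size letter on `Finf j` (height currency, `τ S := ‖(ι_∞ S_{ij})_{ij}‖`, determinant defect) and the FINITE size letter on `∏_v Ffin j … v` (every admissible `D`)
        (N₁ N' N₂ N₃ : ℕ)
        (harch : ∀ z : ℂ, 0 < z.re → ∃ C a c a' r : ℝ, 0 ≤ C ∧ 0 ≤ a ∧ 0 < c ∧ 0 ≤ a' ∧ 0 < r ∧ ∀ (j : Fin m)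
          (S : skewMatrices ((IsCMField.complexConj L : L ≃ₐ[Fp L] L) : L →+* L) ((gramR L e dV hdV dW hdW).map (algebraMap (Fp L) L))) (s : ℂ),
          dist s z < r → ∀ h : HA L e dV hdV dW hdW,
          ‖Finf j S s h‖ ≤ C * adelicHeightGL (n + n) L (h : GL (Fin (n + n)) (AdeleRing (𝓞 L) L)) ^ a *
            (Real.exp (-(c * adelicHeightGL (n + n) L (h : GL (Fin (n + n)) (AdeleRing (𝓞 L) L)) ^ (-a') *
                ‖(fun i j => NumberField.mixedEmbedding L ((S : Matrix (Fin n) (Fin n) L) i j))‖)) *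
              (1 + ‖(fun i j => NumberField.mixedEmbedding L ((S : Matrix (Fin n) (Fin n) L) i j))‖) ^ N₁) *
            ∏ w : InfinitePlace L, (1 + (w (S : Matrix (Fin n) (Fin n) L).det)⁻¹) ^ N')
        (hfsize : ∀ z : ℂ, 0 < z.re → ∃ C a r : ℝ, 0 ≤ C ∧ 0 ≤ a ∧ 0 < r ∧ ∀ (j : Fin m)
          (S : skewMatrices ((IsCMField.complexConj L : L ≃ₐ[Fp L] L) : L →+* L) ((gramR L e dV hdV dW hdW).map (algebraMap (Fp L) L))) (s : ℂ),
          dist s z < r → ∀ (h : HA L e dV hdV dW hdW) (D : ℕ), 1 ≤ D → (∀ a b, IsIntegral ℤ ((D : L) * (S : Matrix (Fin n) (Fin n) L) a b)) →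
          ‖∏ v ∈ kindWFinset L e dV hdV dW hdW T₀ (S : Matrix (Fin n) (Fin n) L) h, Ffin j S h v s‖ ≤
            C * adelicHeightGL (n + n) L (h : GL (Fin (n + n)) (AdeleRing (𝓞 L) L)) ^ a *
              (1 + ‖(fun i j => NumberField.mixedEmbedding L ((S : Matrix (Fin n) (Fin n) L) i j))‖) ^ N₂ * (D : ℝ) ^ N₃),
    ∃ (A : skewMatrices ((IsCMField.complexConj L : L ≃ₐ[Fp L] L) : L →+* L) ((gramR L e dV hdV dW hdW).map (algebraMap (Fp L) L)) → ℂ → HA L e dV hdV dW hdW → ℂ)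
      (U : skewMatrices ((IsCMField.complexConj L : L ≃ₐ[Fp L] L) : L →+* L) ((gramR L e dV hdV dW hdW).map (algebraMap (Fp L) L)) → HA L e dV hdV dW hdW →
        Set (HeightOneSpectrum (𝓞 ↥(maximalRealSubfield L)))),
      (∀ S : skewMatrices ((IsCMField.complexConj L : L ≃ₐ[Fp L] L) : L →+* L) ((gramR L e dV hdV dW hdW).map (algebraMap (Fp L) L)),
        (S : Matrix (Fin n) (Fin n) L).det ≠ 0 → ∀ (s : ℂ) (h : HA L e dV hdV dW hdW), (n : ℝ) / 2 < s.re →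
          whittakerDelta L e dV hdV dW hdW νN (S : Matrix (Fin n) (Fin n) L) (f s) h =
            A S s h * (partialStandardL (U S h) (fun _ => {1}) (2 * s + 1) *
              partialStandardL (U S h) (fun v => {(quadraticHeckeCharCM L).valueAtUniformizer v}) (2 * s + 2))⁻¹) ∧
      (∀ S (h : HA L e dV hdV dW hdW), DifferentiableOn ℂ (fun s => A S s h) {s : ℂ | 0 < s.re}) ∧
      ∃ (τ : skewMatrices ((IsCMField.complexConj L : L ≃ₐ[Fp L] L) : L →+* L) ((gramR L e dV hdV dW hdW).map (algebraMap (Fp L) L)) → ℝ) (NW : ℕ),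
        (∀ S : skewMatrices ((IsCMField.complexConj L : L ≃ₐ[Fp L] L) : L →+* L) ((gramR L e dV hdV dW hdW).map (algebraMap (Fp L) L)),
          ‖(fun i j => NumberField.mixedEmbedding L ((S : Matrix (Fin n) (Fin n) L) i j))‖ ≤ τ S) ∧
        (∀ z : ℂ, 0 < z.re → ∃ C a c a' r : ℝ, 0 ≤ C ∧ 0 ≤ a ∧ 0 < c ∧ 0 ≤ a' ∧ 0 < r ∧ ∀ S (s : ℂ), dist s z < r → ∀ h : HA L e dV hdV dW hdW,
          ‖A S s h‖ ≤ C * adelicHeightGL (n + n) L (h : GL (Fin (n + n)) (AdeleRing (𝓞 L) L)) ^ a *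
            (Real.exp (-(c * adelicHeightGL (n + n) L (h : GL (Fin (n + n)) (AdeleRing (𝓞 L) L)) ^ (-a') * τ S)) * (1 + τ S) ^ NW)) ∧
        ∃ CW κ : ℝ, 0 < CW ∧ 0 ≤ κ ∧
          ∀ S (s : ℂ) (h : HA L e dV hdV dW hdW), 0 < s.re → A S s h ≠ 0 →
            ∃ D : ℕ, 1 ≤ D ∧ (D : ℝ) ≤ CW * adelicHeightGL (n + n) L (h : GL (Fin (n + n)) (AdeleRing (𝓞 L) L)) ^ κ ∧
              ∀ i j, IsIntegral ℤ ((D : L) * (S : Matrix (Fin n) (Fin n) L) i j) := by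
  -- the carriers (★ p862988), unpacked by projections (an `obtain` on this instance-laden goal times out)
  have h := exists_kindW_carrierLetters L e dV hdV dW hdW (toHeckeCharacter L lam⁻¹) νN
  have h1 := h.choose_spec
  have h2 := h1.choose_spec
  have h3 := h2.choose_spec
  have h4 := h3.choose_spec
  have h5 := h4.2.choose_spec
  refine ⟨h.choose, h1.choose, h2.choose, h3.choose, h4.2.choose, h5.1, h4.1, h5.2.1, h5.2.2, ?_⟩
  intro fT hfac hJ m Finf Ffin hFinf hFfin hPart Tδ δ hδ k hfsupp N₁ N' N₂ N₃ harch hfsize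
  haveI := h2.choose
  haveI := h3.choose
  exact kindW_block_of_record L e dV hdV hdV0 dW hdW hdW0 lam 𝒦 f hstd hcont νN h.choose h1.choose h4.1 h4.2.choose h5.1 h5.2.1 h5.2.2 hfac hJ
    Finf Ffin hFinf hFfin hPart Tδ δ hδ k hfsupp N₁ N' N₂ N₃ harch hfsize

end Summit.HodgeConjecture.HodgeConjecture.Cruxes.HLiu418.K2LiuKindWBlockOfRecordCM

end
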